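import Literature.NumberTheory.Automorphic.AsaiSignContOfAsaiHolomorphyJSAtOne
import Literature.NumberTheory.Automorphic.AsaiSignContProofsL2
import Literature.NumberTheory.Automorphic.PairLFunctionPolesEqConjLandau
import Literature.NumberTheory.Automorphic.PairLFunctionPolesEqConjLeTwo
import Literature.NumberTheory.Automorphic.PairLFunctionPolesRepDataProofs
import Literature.NumberTheory.Automorphic.PartialAsaiLHolomorphy
import HarnessLib

/-!
# Mok's Asai-pole dichotomy from Grbac–Shahidi's holomorphy and Arthur–Clozel's (2.3) (or
# Mœglin–Waldspurger's Corollaire (ii)) ALONE: the strict Jacquet–Shalika bound from `L(s, π × π̄)` at `s = 1`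

Topic `NumberTheory/Automorphic`; namespace `Literature.NumberTheory.Automorphic`. Proof file
(theorems only: no definition, no named fact, no instance), eighth sibling of `AsaiSignCont` (the
named fact `Mok2014_partialAsaiL_continuation_pole_dichotomy`, "T": for a conjugate self-dual cuspidal
`Π` on `GL_N(𝔸_E)`, `E/F` quadratic, exactly one of the partial Asai `L`-functions `L^S(s, Π, As^±)`
has a (simple) pole at `s = 1`, the other being holomorphic and non-zero there, both continuing to
`{1/2 < Re s}`), after `AsaiSignContProofs` (T from `hHol` + `hRS`), `AsaiSignContProofsL2`
(T from `hHol`, Mœglin–Waldspurger's Corollaire (ii) `hMW`, Jacquet–Shalika's (2.3) `hJS` and the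
non-vanishing `hNV` of the unramified Asai factors at `s = 1`), `AsaiSignContRankOne` (T proved in
rank one), `AsaiSignContOfAsaiHolomorphy` / `AsaiSignContOfAsaiHolomorphyJSAtOne` (T from
Grbac–Shahidi's holomorphy `hGS` and the Jacquet–Shalika / multiplicity-one facts at `s = 1`).

## What is proved

* `Mok2014_partialAsaiL_continuation_pole_dichotomy_of_GrbacShahidi2015_of_JS` (**main**) — T
  follows from the NAMED FACT `GrbacShahidi2015_partialAsaiL_holomorphy` (Grbac–Shahidi 2015,
  Thm. 4.3 (1), (2)(a), vendored in `PartialAsaiLHolomorphy`; only clause (2)(a) is used) and the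
  NAMED FACT `JacquetShalika1981_partialPairL_pole_of_eq_conj` (Arthur–Clozel's (2.3): `L^S(s, π ⊗ π̃)`
  has a simple pole at `s = 1`, `(s - 1) L^S → c ≠ 0`) over every number field, in every rank, for
  every automorphic measure — and NOTHING ELSE.  Compared with
  `Mok2014_partialAsaiL_continuation_pole_dichotomy_of_asaiEntire_of_L2` the hypotheses
  `JacquetShalika1981_partialPairL_at_one_of_ne_conj` ((2.2) at `s = 1`) and `multiplicity_one_gl` are
  gone; compared with `Mok2014_partialAsaiL_continuation_pole_dichotomy_of_holomorphy_of_L2` the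
  hypotheses `hMW` and `hNV` are gone and `hHol` is fed by `hGS`.  (2.3) is a theorem of the tree in
  ranks `≤ 2` (`JacquetShalika1981_partialPairL_pole_of_eq_conj_holds_of_le_two`) and follows from
  Mœglin–Waldspurger's Corollaire (ii) in general
  (`JacquetShalika1981_partialPairL_pole_of_eq_conj_of_moeglinWaldspurger`), whence:
* `Mok2014_partialAsaiL_continuation_pole_dichotomy_of_GrbacShahidi2015_of_MW` — T from the named
  facts `GrbacShahidi2015_partialAsaiL_holomorphy` and `MoeglinWaldspurger1989_partialPairL_of_eq_conj`
  (Corollaire (ii): `s (s - 1) L^S(s, π ⊗ π̄)` is entire) alone — exactly the two inputs modulo which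
  the sibling unit closes `GrbacShahidi2015_partialAsaiL_at_one`
  (`GrbacShahidi2015_partialAsaiL_at_one_of_asaiHolomorphy_of_moeglinWaldspurger`);
* `CuspidalAutomorphicRepData.exists_sign_partialAsaiL_continuation_of_asaiEntire_of_le_two` — **in
  ranks `N ≤ 2` the body of T for a conjugate self-dual cuspidal `Π` follows from Grbac–Shahidi's
  (2)(a) at `(F, E, c, N)` ALONE** (rank `1` being moreover a theorem,
  `Mok2014_partialAsaiL_continuation_pole_dichotomy_rank_one`);
* `Mok2014_partialAsaiL_continuation_pole_dichotomy_of_asaiEntire_of_JS`, `…_of_asaiEntire_of_MW` —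
  the global theorems with only the (2)(a) clause of `hGS` as hypothesis (`hGSa`);
  `CuspidalAutomorphicRepData.exists_sign_partialAsaiL_continuation_of_asaiEntire_of_JS` — the
  pointwise form (one `Π`, (2)(a) and (2.3) at its own `(F, E, c, N)`);
* `Mok2014_partialAsaiL_continuation_pole_dichotomy_of_GrbacShahidi2015` — the accepted
  `…_of_asaiHolomorphy_of_L2'` fed with the named fact (T from `hGS` and the three `L²` facts
  (2.2) at `s = 1`, (2.3), multiplicity one), recorded for comparison.
* `norm_satakeParameter_lt_sqrt_of_MW` — **Jacquet–Shalika's STRICT bound `|a| < q_v^{1/2}`**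
  (loc. cit. Cor. (2.5)) for every member of a Satake family of a cuspidal `Π ≤ L²_cusp(GL_n(𝔸_K))`
  at every place off the (finite) exceptional set, from Corollaire (ii) (the tree's
  `norm_lt_sqrt_of_pole_of_eq_conj`, the same bound from the named fact (2.3), is the form used below).
* `CuspidalAutomorphicRepData.pairL_pole_of_isConjSelfDualAE_of_dict_of_JS` — `hRS` at EVERY Asai
  datum of a conjugate self-dual `Π` with a normalised dictionary, from (2.3) alone (no (2.2), no
  multiplicity one): the datum is enlarged by the failure set of conjugate self-duality, (2.3) is
  applied there, and the finitely many unramified pair factors moved back are finite at `s = 1` by the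
  strict bound.
* `CuspidalAutomorphicRepData.eval_asaiLocalPolynomial_at_one_ne_zero_of_dict_of_JS` / `…_of_MW` —
  the hypothesis `hNV` of `Mok2014_partialAsaiL_continuation_pole_dichotomy_of_holomorphy_of_L2`:
  `det(1 - As^θ(t_v) q_v^{-1}) ≠ 0` at every `v ∉ S`, for every Asai datum `(S, A)` of a cuspidal
  `Π` carrying the Satake parameters of some `P ≤ L²_cusp` at every finite place.
* `eval_asaiInertPolynomial_ne_zero_of_norm_mul_lt_one`,
  `eval_satakePairPolynomial_conj_eq_zero_of_norm_eq_sqrt` — local bookkeeping.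

## The argument

Mok (§2.5, p. 20) and Grbac–Shahidi (proof of Thm. 4.3, p. 206) count orders at `s = 1` in
`L^{S_E}(s, Π × Π^c) = L^S(s, Π, As⁺) L^S(s, Π, As⁻)`: the left side has a simple pole ((2.3) of
Jacquet–Shalika for `Π^c ≅ Π^∨`), each factor on the right has order `≥ -1` ((2)(a)).  In the tree
this is `Mok2014_partialAsaiL_continuation_pole_dichotomy_of_holomorphy_of_L2`, which needs, besides
`hHol` (here: `hGS` through the normalised Borel–Jacquet dictionary `z = 0` of
`exists_hasSatakeParamAt_iff_L2_of_asaiEntire`, itself fed by (2)(a) and (2.3)) and Corollaire (ii),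
two more inputs: (2.3) — a THEOREM under Corollaire (ii),
`JacquetShalika1981_partialPairL_pole_of_eq_conj_of_moeglinWaldspurger` (de la Vallée Poussin's
positivity with Landau's lemma, `PairLFunctionPolesEqConjLandau`), and in ranks `≤ 2` outright — and
`hNV`, the finiteness at `s = 1` of the finitely many unramified Asai (or Rankin–Selberg) factors moved
when the exceptional set is shrunk back to `S` (an Asai datum need not contain the finitely many
unramified places where conjugate self-duality of the Satake classes fails); Corollaire (ii) itself
served there only for the holomorphy of `L^{S_E}(s, Π × Π^c)` on `{1 < Re s}`, meanwhile a theorem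
(`differentiableOn_partialPairL_of_isSatakeFamilyOf`), so the assembly below goes through the datum-wise
order count `exists_sign_partialAsaiL_of_continuations` of `AsaiSignContProofs` instead.  `hNV` is where Jacquet–Shalika's STRICT bound `|a| < q_w^{1/2}`
(Cor. (2.5): generic unitary unramified representations) enters the printed proofs; the tree has the
non-strict (5.1.3) as a theorem (`norm_satakeParameter_le_sqrt_holds`) and the strict bound only under
four local facts (`norm_satakeParameter_lt_sqrt_of_isGeneric`).  Here the strict bound is derived
GLOBALLY from (2.3): if `|a| = q_w^{1/2}` for some `a` in the Satake class `A_w` of `P` at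
`w ∉ S`, then `det(1 - A_w ⊗ Ā_w q_w^{-1}) = 0` (the factor `1 - a ā q_w^{-1}`), i.e. the local factor
`L_w(s, P × P̄)` has a pole at `s = 1`; but `(s - 1) L^{S}(s, P × P̄) → c ≠ 0` and
`(s - 1) L^{S ∪ {w}}(s, P × P̄) → c' ≠ 0` (both by (2.3)), and
`L^S = L_w · L^{S ∪ {w}}`, so `det(1 - A_w ⊗ Ā_w q_w^{-s}) (s - 1) L^S → 0 · c = 0 ≠ c'`
(`eval_satakePairPolynomial_ne_zero_of_tendsto_insert`) — contradiction.  With `|a| < q_w^{1/2}` at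
`w` and `c • w` above `v ∉ S`: at a split `v` (`q_w = q_v`) `|a b q_v^{-1}| < 1`
(`eval_satakePairPolynomial_ne_zero_of_lt_sqrt`); at an inert `v` (`q_w = q_v²`, so `|a| < q_v`)
`|θ a q_v^{-1}| < 1` and `|a_i a_j q_v^{-2}| < 1`.  (Jacquet–Shalika I, p. 556, derive (5.1.3) the same
way from the convergence of `L_S(s, π × π̄)` on `Re s > 1`; one more place of continuation gives the
strict inequality.)

What this does NOT give: `hGS` (Langlands–Shahidi theory on `U(N, N)` with Mok's endoscopic
classification; the named fact `GrbacShahidi2015_partialAsaiL_holomorphy`, no `_holds`) and, in ranks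
`N ≥ 3`, (2.3) (the named fact `JacquetShalika1981_partialPairL_pole_of_eq_conj`; from Corollaire (ii),
the named fact `MoeglinWaldspurger1989_partialPairL_of_eq_conj`, proved in the tree in rank one only,
`MoeglinWaldspurger1989_partialPairL_of_eq_conj_one`).  After this file the named fact
`Mok2014_partialAsaiL_continuation_pole_dichotomy` is closed modulo `GrbacShahidi2015_partialAsaiL_holomorphy`
(clause (2)(a)) and, in ranks `N ≥ 3` only, `JacquetShalika1981_partialPairL_pole_of_eq_conj`.

## References

* C. P. Mok, *Endoscopic classification of representations of quasi-split unitary groups*,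
  Mem. Amer. Math. Soc. 235 (2015), no. 1108, §2.5 (paragraph before Thm. 2.5.4) and Thm. 2.5.4 (a),
  p. 20. [Mok2014]
* N. Grbac, F. Shahidi, *Endoscopic transfer for unitary groups and holomorphy of Asai
  `L`-functions*, Pacific J. Math. 276 (2015), 185–211: Thm. 4.3 (pp. 190–191, 204) and its proof,
  pp. 204–206. [GrbacShahidi2015]
* C. Mœglin, J.-L. Waldspurger, *Le spectre résiduel de `GL(n)`*, Ann. Sci. ÉNS (4) 22 (1989),
  Appendice, Corollaire (ii), p. 667. [MoeglinWaldspurger1989]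
* H. Jacquet, J. A. Shalika, *On Euler products and the classification of automorphic
  representations I*, Amer. J. Math. 103 (1981): Cor. (2.5), Remark (2.6), (5.1.3), Thm. (5.3) and
  its proof p. 556. [JacquetShalikaAJM1981]
* J. Arthur, L. Clozel, *Simple algebras, base change, and the advanced theory of the trace formula*,
  Ann. of Math. Stud. 120 (1989), Ch. 3 §2 (2.1)–(2.3). [ArthurClozelAMS120]
* Y. Flicker, *Twisted tensors and Euler products*, Bull. SMF 116 (1988), pp. 296–297, 305–306.
  [Flicker1988]
-/

noncomputable section

open scoped Topology
open NumberField IsDedekindDomain Filter Polynomial MeasureTheory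

namespace Literature.NumberTheory.Automorphic

open AdelicGroupData

/-! ### Local bookkeeping -/

section Local

/-- **The unramified Asai factor at an inert place is finite at a point `x` with `|a| |x| < 1` for
all Satake parameters `a`**: `det(1 - As^η(t_v) x) = ∏_i (1 - η a_i x) ∏_{i<j} (1 - a_i a_j x²) ≠ 0`,
each `η a_i x` and `a_i a_j x² = (a_i x)(a_j x)` having absolute value `< 1`.  At `x = q_v^{-1}`
with `q_w = q_v²` this is the finiteness of `L(s, Π_v, As^±)` at `s = 1` under `|a_i| < q_w^{1/2}`.
[cite: Flicker1988, pp. 305–306] [cite: JacquetShalikaAJM1981, Cor. (2.5)] -/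
theorem eval_asaiInertPolynomial_ne_zero_of_norm_mul_lt_one (η : ℤˣ) (α : Multiset ℂ) {x : ℂ}
    (h : ∀ a ∈ α, ‖a‖ * ‖x‖ < 1) : (asaiInertPolynomial η α).eval x ≠ 0 := by
  rw [asaiInertPolynomial, eval_mul, eval_multiset_prod, eval_multiset_prod, Multiset.map_map,
    Multiset.map_map]
  refine mul_ne_zero (Multiset.prod_ne_zero fun h0 => ?_) (Multiset.prod_ne_zero fun h0 => ?_)
  · obtain ⟨a, ha, h'⟩ := Multiset.mem_map.mp h0
    simp only [Function.comp_apply, eval_sub, eval_one, eval_mul, eval_C, eval_X] at h'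
    have h1 : ((η : ℤ) : ℂ) * a * x = 1 := (sub_eq_zero.mp h').symm
    have hη : ‖((η : ℤ) : ℂ)‖ = 1 := by
      rcases Int.units_eq_one_or η with rfl | rfl <;> simp
    have hlt : ‖((η : ℤ) : ℂ) * a * x‖ < 1 := by
      rw [norm_mul, norm_mul, hη, one_mul]
      exact h a ha
    rw [h1, norm_one] at hlt
    exact lt_irrefl _ hlt
  · obtain ⟨p, hp, h'⟩ := Multiset.mem_map.mp h0
    simp only [Function.comp_apply, eval_sub, eval_one, eval_mul, eval_C, eval_pow, eval_X] at h'
    have h1 : p.prod * x ^ 2 = 1 := (sub_eq_zero.mp h').symm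
    obtain ⟨hple, hpcard⟩ := Multiset.mem_powersetCard.mp hp
    obtain ⟨a, b, rfl⟩ := Multiset.card_eq_two.mp hpcard
    have ha : a ∈ α := Multiset.mem_of_le hple (by simp)
    have hb : b ∈ α := Multiset.mem_of_le hple (by simp)
    have hlt : ‖({a, b} : Multiset ℂ).prod * x ^ 2‖ < 1 := by
      rw [Multiset.prod_pair]
      calc ‖a * b * x ^ 2‖ = (‖a‖ * ‖x‖) * (‖b‖ * ‖x‖) := by
            rw [norm_mul, norm_mul, norm_pow]; ring
        _ < 1 := mul_lt_one_of_nonneg_of_lt_one_left (by positivity) (h a ha) (h b hb).le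
    rw [h1, norm_one] at hlt
    exact lt_irrefl _ hlt

/-- **A Satake parameter of absolute value exactly `q^{1/2}` makes the unramified factor
`L(s, π_v × π̄_v)` singular at `s = 1`**: if `a ∈ α` with `|a| = q^{1/2}` then
`det(1 - A ⊗ Ā q⁻¹) = ∏_{i,j} (1 - a_i ā_j q⁻¹) = 0`, the factor `(i, j) = (a, a)` being
`1 - |a|² / q = 0`. [folklore] -/
theorem eval_satakePairPolynomial_conj_eq_zero_of_norm_eq_sqrt {α : Multiset ℂ} {q : ℕ}
    (hq : 0 < q) {a : ℂ} (ha : a ∈ α) (hnorm : ‖a‖ = Real.sqrt q) :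
    (satakePairPolynomial α (α.map (starRingEnd ℂ))).eval ((q : ℂ) ^ (-(1 : ℂ))) = 0 := by
  rw [satakePairPolynomial_eq_eulerPolynomial, eval_eulerPolynomial]
  refine Multiset.prod_eq_zero (Multiset.mem_map.mpr ⟨a * starRingEnd ℂ a, ?_, ?_⟩)
  · show a * starRingEnd ℂ a ∈
      Multiset.map (fun p : ℂ × ℂ => p.1 * p.2) (α ×ˢ α.map (starRingEnd ℂ))
    exact Multiset.mem_map.mpr
      ⟨(a, starRingEnd ℂ a), Multiset.mem_product.mpr ⟨ha, Multiset.mem_map_of_mem _ ha⟩, rfl⟩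
  · have hq0 : (q : ℂ) ≠ 0 := Nat.cast_ne_zero.mpr hq.ne'
    have haa : a * starRingEnd ℂ a = (q : ℂ) := by
      rw [Complex.mul_conj, Complex.normSq_eq_norm_sq, hnorm, Real.sq_sqrt (Nat.cast_nonneg q),
        Complex.ofReal_natCast]
    rw [haa, Complex.cpow_neg_one, mul_inv_cancel₀ hq0, sub_self]

end Local

/-! ### The strict Jacquet–Shalika bound from Mœglin–Waldspurger's Corollaire (ii) -/

section StrictBound

variable {n : ℕ} {K : Type} [Field K] [NumberField K]
  {μ : Measure (gl n K).automorphicQuotient} [(gl n K).IsAutomorphicMeasure μ]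

/-- **Jacquet–Shalika's strict bound `|a| < q_v^{1/2}` from Corollaire (ii).**  For a cuspidal
`Π ≤ L²_cusp(GL_n(𝔸_K))` (`n ≥ 1`), a Satake family `α` of `Π` off a finite `S` and `v ∉ S`, every
`a ∈ α v` has `|a| < q_v^{1/2}` — printed as Cor. (2.5) with Remark (2.6)(3) (generic unitary
unramified local components), here obtained from the CONTINUATION of `L^S(s, Π × Π̄)`: `|a| ≤ q_v^{1/2}`
is (5.1.3) (`norm_satakeParameter_le_sqrt_holds`); if `|a| = q_v^{1/2}` then
`det(1 - A_v ⊗ Ā_v q_v^{-1}) = 0` (`eval_satakePairPolynomial_conj_eq_zero_of_norm_eq_sqrt`), whereas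
`(s - 1) L^S(s, Π × Π̄) → c ≠ 0` and `(s - 1) L^{S ∪ {v}}(s, Π × Π̄) → c' ≠ 0` at `s = 1`
((2.3) from Corollaire (ii) by de la Vallée Poussin–Landau,
`JacquetShalika1981_partialPairL_pole_of_eq_conj_of_moeglinWaldspurger`, at `S` and at `S ∪ {v}`) force
`det(1 - A_v ⊗ Ā_v q_v^{-1}) ≠ 0` (`eval_satakePairPolynomial_ne_zero_of_tendsto_insert`:
`L^S = L_v · L^{S ∪ {v}}` near `s = 1`; multipliability by Jacquet–Shalika's (2.1),
`JacquetShalika1981_multipliable_partialPairL_holds`) — the tree's `norm_lt_sqrt_of_pole_of_eq_conj`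
(the strict bound from the named fact (2.3)) composed with (2.3) from Corollaire (ii).  Jacquet–Shalika I,
p. 556, obtain (5.1.3) from the convergence of `L_S(s, π × π̄)` for `Re s > 1` in exactly this way; the
continuation at one more place sharpens `≤` to `<`.
[cite: JacquetShalikaAJM1981, Cor. (2.5), Remark (2.6)(3), (5.1.3), p. 556]
[cite: MoeglinWaldspurger1989, Appendice, Corollaire (ii), p. 667] -/
theorem norm_satakeParameter_lt_sqrt_of_MW
    (hMW : MoeglinWaldspurger1989_partialPairL_of_eq_conj (n := n) (K := K) (μ := μ)) (hn : 0 < n)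
    (P : CuspidalAutomorphicRepGL n K μ) {S : Set (HeightOneSpectrum (𝓞 K))} (hS : S.Finite)
    {α : SatakeFamily K} (hα : IsSatakeFamilyOf P S α) {v : HeightOneSpectrum (𝓞 K)} (hv : v ∉ S)
    {a : ℂ} (ha : a ∈ α v) : ‖a‖ < Real.sqrt v.residueCard :=
  norm_lt_sqrt_of_pole_of_eq_conj
    (JacquetShalika1981_partialPairL_pole_of_eq_conj_of_moeglinWaldspurger hMW) hn P hS hα hv ha

end StrictBound

/-! ### `hNV` at every Asai datum from a normalised dictionary and Corollaire (ii) -/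

section Datum

variable {F E : Type} [Field F] [NumberField F] [Field E] [NumberField E] [Algebra F E]
  {N : ℕ} {hcpt : isCompact_glFiniteIntegralLevel N E}

/-- **The unramified Asai factors of a cuspidal `Π` are finite at `s = 1`, from (2.3).**
For a quadratic `E/F`, a cuspidal `Π` on `GL_N(𝔸_E)` (`N ≥ 1`) carrying at every finite place the
Satake parameters of a cuspidal `P ≤ L²_cusp(μ)` (`hdict`, the normalised Borel–Jacquet dictionary of
`exists_hasSatakeParamAt_iff_L2_of_asaiEntire`), an Asai datum `(S, A)`, a sign `θ` and `v ∉ S` with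
`w | v` the chosen place above: `det(1 - As^θ(t_v) q_v^{-1}) ≠ 0`.  For `A` is an `L²` family of
`P` off `S_E`, so `|a| < q_w^{1/2}` on `A w` and on `A (c • w)` (`norm_lt_sqrt_of_pole_of_eq_conj`);
at a split `v` (`c • w ≠ w`, `f(w|v) = 1`, `q_w = q_v`) the factor is `det(1 - t_w ⊗ t_{c • w} q_v^{-1})`,
non-zero by `eval_satakePairPolynomial_ne_zero_of_lt_sqrt`; at an inert `v` (`c • w = w`,
`f(w|v) = 2` by the datum, `q_w = q_v²`, so `|a| < q_v`) it is
`∏_i (1 - θ a_i q_v^{-1}) ∏_{i<j} (1 - a_i a_j q_v^{-2})`, non-zero by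
`eval_asaiInertPolynomial_ne_zero_of_norm_mul_lt_one`.  This is hypothesis `hNV` of
`Mok2014_partialAsaiL_continuation_pole_dichotomy_of_holomorphy_of_L2` ("with Jacquet–Shalika's strict
bound for generic unitary `Π_w`, Cor. 2.5 loc. cit., every such factor is finite and non-zero").
[cite: JacquetShalikaAJM1981, Cor. (2.5)] [cite: Flicker1988, pp. 296, 305–306]
[cite: ArthurClozelAMS120, Ch. 3 §2 (2.3)] -/
theorem CuspidalAutomorphicRepData.eval_asaiLocalPolynomial_at_one_ne_zero_of_dict_of_JS
    (h23 : ∀ (μ : Measure (gl N E).automorphicQuotient) [(gl N E).IsAutomorphicMeasure μ],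
      JacquetShalika1981_partialPairL_pole_of_eq_conj (n := N) (K := E) (μ := μ))
    (h2 : Module.finrank F E = 2) {c : E ≃ₐ[F] E} (hN : 0 < N)
    (π : CuspidalAutomorphicRepData N E hcpt)
    (hdict : ∀ (μ : Measure (gl N E).automorphicQuotient) [(gl N E).IsAutomorphicMeasure μ],
      ∃ P : CuspidalAutomorphicRepGL N E μ, ∀ (v : HeightOneSpectrum (𝓞 E)) (β : Multiset ℂ),
        π.1.HasSatakeParamAt v β ↔
          ∃ (𝔫 : Ideal (𝓞 E)) (ϖ : (v.adicCompletion E)ˣ), 𝔫 ≠ 0 ∧ ¬ v.asIdeal ∣ 𝔫 ∧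
            HasSatakeParameterAt P.1 (principalCongruenceLevel N E 𝔫) v ϖ β)
    {S : Set (HeightOneSpectrum (𝓞 F))} {A : SatakeFamily E} (hSA : π.1.IsAsaiDatum c S A)
    (θ : ℤˣ) {v : HeightOneSpectrum (𝓞 F)} (hv : v ∉ S) :
    (asaiLocalPolynomial c A θ (placeAbove E v)).eval ((v.residueCard : ℂ) ^ (-(1 : ℂ))) ≠ 0 := by
  classical
  obtain ⟨μ, hμ⟩ := AdelicGroupData.exists_isAutomorphicMeasure_gl_holds (n := N) (K := E)
  haveI := hμ
  obtain ⟨P, hdictP⟩ := hdict μ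
  set SE : Set (HeightOneSpectrum (𝓞 E)) := {w | w.under (𝓞 F) ∈ S} with hSE
  have hSEfin : SE.Finite := finite_setOf_under_mem hSA.finite
  -- `A` is an `L²` family of `P` off `S_E`
  have hα : IsSatakeFamilyOf P SE A := by
    intro w hw
    obtain ⟨𝔫, ϖ, h𝔫, hw𝔫, hSat⟩ := (hdictP w (A w)).mp (hSA.hasSatakeParamAt hw)
    exact ⟨𝔫, h𝔫, hw𝔫, ϖ, hSat⟩
  -- the chosen place `w` above `v` and its conjugate, both off `S_E`
  set w : HeightOneSpectrum (𝓞 E) := placeAbove E v with hwdef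
  have hwv : w.under (𝓞 F) = v := placeAbove_under v
  have hcwv : (c • w).under (𝓞 F) = v := by rw [HeightOneSpectrum.under_algEquiv_smul, hwv]
  have hwS : w ∉ SE := fun h => hv (by
    have h' : w.under (𝓞 F) ∈ S := h
    rwa [hwv] at h')
  have hcwS : c • w ∉ SE := fun h => hv (by
    have h' : (c • w).under (𝓞 F) ∈ S := h
    rwa [hcwv] at h')
  -- the strict bound at `w` and at `c • w` (`q_{c • w} = q_w`)
  have hlt : ∀ a ∈ A w, ‖a‖ < Real.sqrt w.residueCard := fun a ha =>
    norm_lt_sqrt_of_pole_of_eq_conj (h23 μ) hN P hSEfin hα hwS ha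
  have hltc : ∀ a ∈ A (c • w), ‖a‖ < Real.sqrt w.residueCard := fun a ha => by
    have h := norm_lt_sqrt_of_pole_of_eq_conj (h23 μ) hN P hSEfin hα hcwS ha
    rwa [residueCard_smul F c w] at h
  have hqv : 1 < v.residueCard := v.one_lt_residueCard
  by_cases hcw : c • w = w
  · -- inert `v`: `q_w = q_v²`, the factor is `∏ (1 - θ a q_v^{-1}) ∏ (1 - a_i a_j q_v^{-2})`
    have hf : w.asIdeal.inertiaDeg (𝓞 F) = 2 :=
      hSA.inertiaDeg_eq_two (by rw [hwv]; exact hv) hcw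
    have hq : w.residueCard = v.residueCard ^ 2 := by
      rw [residueCard_eq_pow_inertiaDeg (F := F) w, hwv, hf]
    have hsqrt : Real.sqrt w.residueCard = v.residueCard := by
      rw [hq, Nat.cast_pow, Real.sqrt_sq (Nat.cast_nonneg _)]
    rw [asaiLocalPolynomial_of_smul_eq A θ hcw]
    refine eval_asaiInertPolynomial_ne_zero_of_norm_mul_lt_one θ (A w) fun a ha => ?_
    have hq0 : (0 : ℝ) < v.residueCard := by exact_mod_cast zero_lt_one.trans hqv
    have ha' : ‖a‖ < v.residueCard := hsqrt ▸ hlt a ha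
    rw [Complex.cpow_neg_one, norm_inv, Complex.norm_natCast, ← div_eq_mul_inv, div_lt_one hq0]
    exact ha'
  · -- split `v`: `q_w = q_v`, the factor is `det(1 - t_w ⊗ t_{c • w} q_v^{-1})`
    have hf : w.asIdeal.inertiaDeg (𝓞 F) = 1 :=
      HeightOneSpectrum.inertiaDeg_eq_one_of_smul_ne h2 hcw
    have hq : w.residueCard = v.residueCard := by
      rw [residueCard_eq_pow_inertiaDeg (F := F) w, hwv, hf, pow_one]
    rw [asaiLocalPolynomial_of_smul_ne A θ hcw]
    refine eval_satakePairPolynomial_ne_zero_of_lt_sqrt hqv (fun a ha => ?_) (fun b hb => ?_)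
      Complex.one_re
    · have h := hlt a ha
      rwa [hq] at h
    · have h := (hltc b hb).le
      rwa [hq] at h

/-- **The unramified Asai factors of a cuspidal `Π` are finite at `s = 1`, from Corollaire (ii)**
(`eval_asaiLocalPolynomial_at_one_ne_zero_of_dict_of_JS` with (2.3) supplied by
`JacquetShalika1981_partialPairL_pole_of_eq_conj_of_moeglinWaldspurger`): hypothesis `hNV` of
`Mok2014_partialAsaiL_continuation_pole_dichotomy_of_holomorphy_of_L2` for a cuspidal `Π` carrying the
Satake parameters of some `P ≤ L²_cusp` at every finite place. [cite: JacquetShalikaAJM1981, Cor. (2.5)]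
[cite: MoeglinWaldspurger1989, Appendice, Corollaire (ii), p. 667] -/
theorem CuspidalAutomorphicRepData.eval_asaiLocalPolynomial_at_one_ne_zero_of_dict_of_MW
    (hMW : ∀ (μ : Measure (gl N E).automorphicQuotient) [(gl N E).IsAutomorphicMeasure μ],
      MoeglinWaldspurger1989_partialPairL_of_eq_conj (n := N) (K := E) (μ := μ))
    (h2 : Module.finrank F E = 2) {c : E ≃ₐ[F] E} (hN : 0 < N)
    (π : CuspidalAutomorphicRepData N E hcpt)
    (hdict : ∀ (μ : Measure (gl N E).automorphicQuotient) [(gl N E).IsAutomorphicMeasure μ],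
      ∃ P : CuspidalAutomorphicRepGL N E μ, ∀ (v : HeightOneSpectrum (𝓞 E)) (β : Multiset ℂ),
        π.1.HasSatakeParamAt v β ↔
          ∃ (𝔫 : Ideal (𝓞 E)) (ϖ : (v.adicCompletion E)ˣ), 𝔫 ≠ 0 ∧ ¬ v.asIdeal ∣ 𝔫 ∧
            HasSatakeParameterAt P.1 (principalCongruenceLevel N E 𝔫) v ϖ β)
    {S : Set (HeightOneSpectrum (𝓞 F))} {A : SatakeFamily E} (hSA : π.1.IsAsaiDatum c S A)
    (θ : ℤˣ) {v : HeightOneSpectrum (𝓞 F)} (hv : v ∉ S) :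
    (asaiLocalPolynomial c A θ (placeAbove E v)).eval ((v.residueCard : ℂ) ^ (-(1 : ℂ))) ≠ 0 :=
  π.eval_asaiLocalPolynomial_at_one_ne_zero_of_dict_of_JS
    (fun μ _ => JacquetShalika1981_partialPairL_pole_of_eq_conj_of_moeglinWaldspurger (hMW μ))
    h2 hN hdict hSA θ hv

/-- **`hRS` at every Asai datum of a conjugate self-dual `Π` with a normalised dictionary, from (2.3)
alone** — `CuspidalAutomorphicRepData.pairL_pole_of_isConjSelfDualAE_of_dict` of
`AsaiSignContOfAsaiHolomorphyJSAtOne` WITHOUT (2.2) at `s = 1` and multiplicity one.  For a quadratic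
`E/F` with involution `c` (`c² = 1`), `Π` cuspidal on `GL_N(𝔸_E)` (`N ≥ 1`) conjugate self-dual a.e.,
carrying the Satake parameters of a cuspidal `P ≤ L²_cusp(μ)` at every finite place, and ANY Asai datum
`(S, A)`: `R(s) = L^{S_E}(s, A ⊗ A^c)` is multipliable and holomorphic on `{1 < Re s}` (Jacquet–Shalika
I, Thm. (5.3), for the `L²` pair `(P, U_c P)` with families `(A, A ∘ c)`), and `(s - 1) R(s) → r ≠ 0`
as `s → 1⁺`.  The pole: enlarge `S` by the finitely many places below the failure set `B` of
`A(c w) = A(w)⁻¹`; off `S''_E = (S ∪ B_F)_E` the pair factor of `(A, A ∘ c)` is that of `(A, \bar A)`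
(`IsSatakeFamilyOf.map_inv_eq_map_conj`), so `(s - 1) L^{S''_E}(s, A ⊗ A^c) = (s - 1) L^{S''_E}(s, P × P̄)
→ r'' ≠ 0` by (2.3); transport down to `S_E` (`exists_ne_zero_tendsto_mul_partialPairL_of_subset`), the
finitely many moved factors `det(1 - t_w ⊗ t_{cw} q_w^{-1})`, `w ∈ S''_E ∖ S_E`, being non-zero by the
strict bound at `w` (`norm_lt_sqrt_of_pole_of_eq_conj`) and (5.1.3) at `c w`
(`eval_satakePairPolynomial_ne_zero_of_lt_sqrt`).  Mok, §2.5 p. 20: "`L(s, φ^N × (φ^N)^c) = … =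
L(s, φ^N × (φ^N)^∨)`, hence has a simple pole at `s = 1` by [JPSS]" — here for EVERY finite set of
bad places, the unramified factors being finite at `s = 1` by Jacquet–Shalika's Cor. (2.5).
[cite: Mok2014, §2.5 p. 20] [cite: GrbacShahidi2015, proof of Thm. 4.3, p. 206]
[cite: ArthurClozelAMS120, Ch. 3 §2 (2.1), (2.3)] [cite: JacquetShalikaAJM1981, Cor. (2.5), Thm. (5.3)] -/
theorem CuspidalAutomorphicRepData.pairL_pole_of_isConjSelfDualAE_of_dict_of_JS
    (h23 : ∀ (μ : Measure (gl N E).automorphicQuotient) [(gl N E).IsAutomorphicMeasure μ],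
      JacquetShalika1981_partialPairL_pole_of_eq_conj (n := N) (K := E) (μ := μ))
    {c : E ≃ₐ[F] E} (hcc : c * c = 1) (hN : 0 < N) (π : CuspidalAutomorphicRepData N E hcpt)
    (hπ : π.1.IsConjSelfDualAE c)
    (hdict : ∀ (μ : Measure (gl N E).automorphicQuotient) [(gl N E).IsAutomorphicMeasure μ],
      ∃ P : CuspidalAutomorphicRepGL N E μ, ∀ (v : HeightOneSpectrum (𝓞 E)) (β : Multiset ℂ),
        π.1.HasSatakeParamAt v β ↔
          ∃ (𝔫 : Ideal (𝓞 E)) (ϖ : (v.adicCompletion E)ˣ), 𝔫 ≠ 0 ∧ ¬ v.asIdeal ∣ 𝔫 ∧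
            HasSatakeParameterAt P.1 (principalCongruenceLevel N E 𝔫) v ϖ β)
    {S : Set (HeightOneSpectrum (𝓞 F))} {A : SatakeFamily E} (hSA : π.1.IsAsaiDatum c S A) :
    (∀ s : ℂ, 1 < s.re →
      Multipliable fun w : {w : HeightOneSpectrum (𝓞 E) // w.under (𝓞 F) ∉ S} =>
        ((satakePairPolynomial (A w.1) (A (c • w.1))).eval ((w.1.residueCard : ℂ) ^ (-s)))⁻¹) ∧
    DifferentiableOn ℂ
      (partialPairL {w : HeightOneSpectrum (𝓞 E) | w.under (𝓞 F) ∈ S} A (fun w => A (c • w)))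
      {s : ℂ | 1 < s.re} ∧
    ∃ r : ℂ, r ≠ 0 ∧
      Tendsto (fun s => (s - 1) *
          partialPairL {w : HeightOneSpectrum (𝓞 E) | w.under (𝓞 F) ∈ S} A (fun w => A (c • w)) s)
        (𝓝[{s : ℂ | 1 < s.re}] 1) (𝓝 r) := by
  classical
  haveI : NeZero N := ⟨hN.ne'⟩
  obtain ⟨μ, hμ⟩ := AdelicGroupData.exists_isAutomorphicMeasure_gl_holds (n := N) (K := E)
  haveI := hμ
  have hμG : IsGalInvariant F μ :=
    isGalInvariant_of_unique F (isAutomorphicMeasure_unique_smul_holds N E) μ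
  obtain ⟨P, hdictP⟩ := hdict μ
  set SE : Set (HeightOneSpectrum (𝓞 E)) := {w | w.under (𝓞 F) ∈ S} with hSE
  have hSEfin : SE.Finite := finite_setOf_under_mem hSA.finite
  -- `A` is an `L²` family of `P` off `S_E`, `A ∘ c` one of `U_c P`
  have hα : IsSatakeFamilyOf P SE A := by
    intro w hw
    obtain ⟨𝔫, ϖ, h𝔫, hw𝔫, hSat⟩ := (hdictP w (A w)).mp (hSA.hasSatakeParamAt hw)
    exact ⟨𝔫, h𝔫, hw𝔫, ϖ, hSat⟩
  have hcinv : c⁻¹ = c := inv_eq_of_mul_eq_one_right hcc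
  set Pc : CuspidalAutomorphicRepGL N E μ := P.galConj F hμG c with hPc
  have hβ : IsSatakeFamilyOf Pc SE (fun w => A (c • w)) := by
    have h := hα.galConj F hμG c
    rw [hcinv] at h
    refine h.mono fun w hw => ?_
    show w.under (𝓞 F) ∈ S
    have hw' : (c • w).under (𝓞 F) ∈ S := hw
    rwa [HeightOneSpectrum.under_algEquiv_smul] at hw'
  -- the datum enlarged by the places below the failure set `B` of conjugate self-duality
  set B : Set (HeightOneSpectrum (𝓞 E)) := {w | ¬ ∀ α β : Multiset ℂ,
      π.1.HasSatakeParamAt w α → π.1.HasSatakeParamAt (c • w) β → β = α.map (·⁻¹)} with hB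
  have hBfin : B.Finite := Filter.eventually_cofinite.mp hπ
  set S'' : Set (HeightOneSpectrum (𝓞 F)) :=
    S ∪ (fun w : HeightOneSpectrum (𝓞 E) => w.under (𝓞 F)) '' B with hS''
  have hS''fin : S''.Finite := hSA.finite.union (hBfin.image _)
  set SE'' : Set (HeightOneSpectrum (𝓞 E)) := {w | w.under (𝓞 F) ∈ S''} with hSE''
  have hSE''fin : SE''.Finite := finite_setOf_under_mem hS''fin
  have hsub : SE ⊆ SE'' := fun w hw => Or.inl hw
  have hα'' : IsSatakeFamilyOf P SE'' A := hα.mono hsub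
  have hβ'' : IsSatakeFamilyOf Pc SE'' (fun w => A (c • w)) := hβ.mono hsub
  -- off `SE''` the pair factor of `(A, A ∘ c)` is that of `(A, \bar A)`
  have key : ∀ w : HeightOneSpectrum (𝓞 E), w ∉ SE'' → A (c • w) = (A w).map (starRingEnd ℂ) := by
    intro w hw
    have hwS : w.under (𝓞 F) ∉ S := fun h => hw (Or.inl h)
    have hcwS : (c • w).under (𝓞 F) ∉ S := by
      rwa [HeightOneSpectrum.under_algEquiv_smul]
    have hgood : ∀ α β : Multiset ℂ, π.1.HasSatakeParamAt w α →
        π.1.HasSatakeParamAt (c • w) β → β = α.map (·⁻¹) := by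
      by_contra h
      exact hw (Or.inr ⟨w, h, rfl⟩)
    rw [hgood _ _ (hSA.hasSatakeParamAt hwS) (hSA.hasSatakeParamAt hcwS)]
    exact hα.map_inv_eq_map_conj hwS
  have hLL : partialPairL SE'' A (fun w => A (c • w)) =
      partialPairL SE'' A (fun w => (A w).map (starRingEnd ℂ)) := by
    funext s
    unfold partialPairL
    exact tprod_congr fun w => by simp only [key w.1 w.2]
  -- (2.3) at the enlarged datum, for `(P, P̄)` with the families `(A, \bar A)`
  obtain ⟨r'', hr'', hT''⟩ := (h23 μ) hN P P.conj P.conj_conj.symm hSE''fin hα'' hα''.conj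
  rw [← hLL] at hT''
  -- transport down to `S_E`: the moved factors are finite at `s = 1` by the strict bound
  have hfin : (SE'' \ SE).Finite := hSE''fin.subset fun _ h => h.1
  have hmul : ∀ᶠ s in 𝓝[{s : ℂ | 1 < s.re}] (1 : ℂ),
      Multipliable fun u : {u : HeightOneSpectrum (𝓞 E) // u ∉ SE''} =>
        ((satakePairPolynomial (A u.1) (A (c • u.1))).eval ((u.1.residueCard : ℂ) ^ (-s)))⁻¹ :=
    eventually_nhdsWithin_of_forall fun s hs =>
      JacquetShalika1981_multipliable_partialPairL_holds P Pc hα'' hβ'' hs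
  have hne : ∀ u ∈ SE'' \ SE,
      (satakePairPolynomial (A u) (A (c • u))).eval ((u.residueCard : ℂ) ^ (-(1 : ℂ))) ≠ 0 :=
    fun u hu => eval_satakePairPolynomial_ne_zero_of_lt_sqrt u.one_lt_residueCard
      (fun a ha => norm_lt_sqrt_of_pole_of_eq_conj (h23 μ) hN P hSEfin hα hu.2 ha)
      (fun b hb => norm_satakeParameter_le_sqrt_holds Pc hβ hu.2 hb) Complex.one_re
  obtain ⟨r, hr, hT⟩ := exists_ne_zero_tendsto_mul_partialPairL_of_subset (α := A)
    (β := fun w => A (c • w)) (s₀ := 1) hsub hfin (fun s : ℂ => s - 1) hmul hne ⟨r'', hr'', hT''⟩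
  exact ⟨fun s hs => JacquetShalika1981_multipliable_partialPairL_holds P Pc hα hβ hs,
    differentiableOn_partialPairL_of_isSatakeFamilyOf P Pc hα hβ, r, hr, hT⟩

/-- **Mok's dichotomy for ONE conjugate self-dual cuspidal `Π`, from Grbac–Shahidi (2)(a) and (2.3)
at its rank** (pointwise form of `Mok2014_partialAsaiL_continuation_pole_dichotomy_of_asaiEntire_of_JS`).
For a quadratic `E/F` (`c ≠ 1`), `N ≥ 1`, a cuspidal `Π` on `GL_N(𝔸_E)` conjugate self-dual a.e.,
granted (2)(a) in `L²_cusp(GL_N(𝔸_E))` for these `F`, `E`, `c`, `N` (`hGSa`) and Arthur–Clozel's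
(2.3) in rank `N` over `E` (`h23`), every automorphic measure: the body of
`Mok2014_partialAsaiL_continuation_pole_dichotomy` holds for `Π` — there is a sign `η` such that at
every Asai datum `(S, A)` the function `(s - 1) L^S(s, Π, As^η)` continues holomorphically to
`{1/2 < Re s}` with non-zero value at `1`, and `L^S(s, Π, As^{-η})` continues holomorphically to
`{1/2 < Re s}`, non-zero at `1`.  Proof: at each datum, Mok's order count
`exists_sign_partialAsaiL_of_continuations` with clause (i)
(`exists_multipliable_asaiEulerFactors`), `hHol` (`hol_half_plane_of_asaiEntire_of_dict`) and `hRS`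
(`pairL_pole_of_isConjSelfDualAE_of_dict_of_JS`) over the normalised dictionary
`exists_hasSatakeParamAt_iff_L2_of_asaiEntire`; the sign does not depend on the datum
(`AutomorphicRepData.exists_sign_forall_of_forall_exists_sign`).
[cite: Mok2014, §2.5 (paragraph before Thm. 2.5.4) and Thm. 2.5.4 (a), p. 20]
[cite: GrbacShahidi2015, Thm. 4.3 (2)(a) and its proof, pp. 204–206]
[cite: ArthurClozelAMS120, Ch. 3 §2 (2.1), (2.3)] -/
theorem CuspidalAutomorphicRepData.exists_sign_partialAsaiL_continuation_of_asaiEntire_of_JS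
    {c : E ≃ₐ[F] E}
    (hGSa : ∀ (μ : Measure (gl N E).automorphicQuotient) [(gl N E).IsAutomorphicMeasure μ]
      (P : CuspidalAutomorphicRepGL N E μ) (S : Set (HeightOneSpectrum (𝓞 F))) (A : SatakeFamily E)
      (η : ℤˣ), S.Finite →
      IsSatakeFamilyOf P {w : HeightOneSpectrum (𝓞 E) | w.under (𝓞 F) ∈ S} A →
      (∀ w : HeightOneSpectrum (𝓞 E), w.under (𝓞 F) ∉ S → c • w = w →
        w.asIdeal.inertiaDeg (𝓞 F) = 2) →
      ∃ σ₀ : ℝ, 1 ≤ σ₀ ∧ ∃ G : ℂ → ℂ, Differentiable ℂ G ∧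
        ∀ s : ℂ, σ₀ < s.re → G s = s * (s - 1) * partialAsaiL S c A η s)
    (h23 : ∀ (μ : Measure (gl N E).automorphicQuotient) [(gl N E).IsAutomorphicMeasure μ],
      JacquetShalika1981_partialPairL_pole_of_eq_conj (n := N) (K := E) (μ := μ))
    (h2 : Module.finrank F E = 2) (hc : c ≠ 1) (hN : 0 < N) (π : CuspidalAutomorphicRepData N E hcpt)
    (hπ : π.1.IsConjSelfDualAE c) :
    ∃ η : ℤˣ, ∀ (S : Set (HeightOneSpectrum (𝓞 F))) (A : SatakeFamily E),
      π.1.IsAsaiDatum c S A →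
        ∃ σ₀ : ℝ, 1 ≤ σ₀ ∧
          (∀ (θ : ℤˣ) (s : ℂ), σ₀ < s.re →
            Multipliable fun v : {v : HeightOneSpectrum (𝓞 F) // v ∉ S} =>
              ((asaiLocalPolynomial c A θ (placeAbove E v.1)).eval
                ((v.1.residueCard : ℂ) ^ (-s)))⁻¹) ∧
          (∃ G : ℂ → ℂ, DifferentiableOn ℂ G {s : ℂ | 1 / 2 < s.re} ∧
            (∀ s : ℂ, σ₀ < s.re → G s = (s - 1) * partialAsaiL S c A η s) ∧ G 1 ≠ 0) ∧
          (∃ H : ℂ → ℂ, DifferentiableOn ℂ H {s : ℂ | 1 / 2 < s.re} ∧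
            (∀ s : ℂ, σ₀ < s.re → H s = partialAsaiL S c A (-η) s) ∧ H 1 ≠ 0) := by
  classical
  have hdict := fun (μ : Measure (gl N E).automorphicQuotient) (_ : (gl N E).IsAutomorphicMeasure μ) =>
    π.exists_hasSatakeParamAt_iff_L2_of_asaiEntire hGSa h23 h2 hc hN hπ μ
  refine AutomorphicRepData.exists_sign_forall_of_forall_exists_sign fun S A hSA => ?_
  obtain ⟨σ₁, hσ₁, hmulA⟩ := π.exists_multipliable_asaiEulerFactors h2 hN hSA
  obtain ⟨σp, -, Gp, hGp, hGLp⟩ := π.hol_half_plane_of_asaiEntire_of_dict hGSa hdict 1 hSA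
  obtain ⟨σn, -, Gn, hGn, hGLn⟩ := π.hol_half_plane_of_asaiEntire_of_dict hGSa hdict (-1) hSA
  obtain ⟨hmulP, hRhol, r, hr, hpole⟩ := π.pairL_pole_of_isConjSelfDualAE_of_dict_of_JS h23
    (AlgEquiv.mul_self_eq_one_of_finrank_eq_two h2 c) hN hπ hdict hSA
  -- a common right half-plane `{σ < Re s}`
  set σ : ℝ := max σ₁ (max σp σn) with hσdef
  have hσ₁σ : σ₁ ≤ σ := le_max_left _ _
  have hσ : 1 ≤ σ := hσ₁.trans hσ₁σ
  have hσpσ : σp ≤ σ := (le_max_left _ _).trans (le_max_right _ _)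
  have hσnσ : σn ≤ σ := (le_max_right _ _).trans (le_max_right _ _)
  have hmulA' : ∀ (θ : ℤˣ) (s : ℂ), σ < s.re →
      Multipliable fun v : {v : HeightOneSpectrum (𝓞 F) // v ∉ S} =>
        ((asaiLocalPolynomial c A θ (placeAbove E v.1)).eval ((v.1.residueCard : ℂ) ^ (-s)))⁻¹ :=
    fun θ s hs => hmulA θ s (lt_of_le_of_lt hσ₁σ hs)
  have hmulP' : ∀ s : ℂ, σ < s.re →
      Multipliable fun w : {w : HeightOneSpectrum (𝓞 E) // w.under (𝓞 F) ∉ S} =>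
        ((satakePairPolynomial (A w.1) (A (c • w.1))).eval ((w.1.residueCard : ℂ) ^ (-s)))⁻¹ :=
    fun s hs => hmulP s (lt_of_le_of_lt hσ hs)
  have hGLp' : ∀ s : ℂ, σ < s.re → Gp s = (s - 1) * partialAsaiL S c A 1 s :=
    fun s hs => hGLp s (lt_of_le_of_lt hσpσ hs)
  have hGLn' : ∀ s : ℂ, σ < s.re → Gn s = (s - 1) * partialAsaiL S c A (-1) s :=
    fun s hs => hGLn s (lt_of_le_of_lt hσnσ hs)
  have hinert : ∀ w : HeightOneSpectrum (𝓞 E), w.under (𝓞 F) ∉ S → c • w = w →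
      w.asIdeal.inertiaDeg (𝓞 F) = 2 := fun w hw hcw => hSA.inertiaDeg_eq_two hw hcw
  obtain ⟨θ, hP, hH⟩ := exists_sign_partialAsaiL_of_continuations h2 hc hinert hσ hmulA' hmulP'
    hRhol hr hpole hGp hGn hGLp' hGLn'
  exact ⟨θ, σ, hσ, hmulA', hP, hH⟩

/-- **Mok's dichotomy in ranks `N ≤ 2` from Grbac–Shahidi's Thm. 4.3 (2)(a) ALONE.**  In ranks
`N ≤ 2` Arthur–Clozel's (2.3) is a theorem of the tree
(`JacquetShalika1981_partialPairL_pole_of_eq_conj_holds_of_le_two`: the pole of the partial Dedekind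
zeta function in rank `1`, the Rankin–Selberg method with the Kirillov `L²`-bound in rank `2`), so for
a conjugate self-dual cuspidal `Π` on `GL_N(𝔸_E)`, `N ∈ {1, 2}`, the body of
`Mok2014_partialAsaiL_continuation_pole_dichotomy` follows from (2)(a) in `L²_cusp(GL_N(𝔸_E))` for
these `F`, `E`, `c`, `N` and nothing else (in rank `1` even that is a theorem:
`Mok2014_partialAsaiL_continuation_pole_dichotomy_rank_one`, `AsaiSignContRankOne`).
[cite: Mok2014, Thm. 2.5.4 (a), p. 20] [cite: GrbacShahidi2015, Thm. 4.3 (2)(a)]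
[cite: ArthurClozelAMS120, Ch. 3 §2 (2.3)] -/
theorem CuspidalAutomorphicRepData.exists_sign_partialAsaiL_continuation_of_asaiEntire_of_le_two
    {c : E ≃ₐ[F] E}
    (hGSa : ∀ (μ : Measure (gl N E).automorphicQuotient) [(gl N E).IsAutomorphicMeasure μ]
      (P : CuspidalAutomorphicRepGL N E μ) (S : Set (HeightOneSpectrum (𝓞 F))) (A : SatakeFamily E)
      (η : ℤˣ), S.Finite →
      IsSatakeFamilyOf P {w : HeightOneSpectrum (𝓞 E) | w.under (𝓞 F) ∈ S} A →
      (∀ w : HeightOneSpectrum (𝓞 E), w.under (𝓞 F) ∉ S → c • w = w →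
        w.asIdeal.inertiaDeg (𝓞 F) = 2) →
      ∃ σ₀ : ℝ, 1 ≤ σ₀ ∧ ∃ G : ℂ → ℂ, Differentiable ℂ G ∧
        ∀ s : ℂ, σ₀ < s.re → G s = s * (s - 1) * partialAsaiL S c A η s)
    (h2 : Module.finrank F E = 2) (hc : c ≠ 1) (hN : 0 < N) (hN2 : N ≤ 2)
    (π : CuspidalAutomorphicRepData N E hcpt) (hπ : π.1.IsConjSelfDualAE c) :
    ∃ η : ℤˣ, ∀ (S : Set (HeightOneSpectrum (𝓞 F))) (A : SatakeFamily E),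
      π.1.IsAsaiDatum c S A →
        ∃ σ₀ : ℝ, 1 ≤ σ₀ ∧
          (∀ (θ : ℤˣ) (s : ℂ), σ₀ < s.re →
            Multipliable fun v : {v : HeightOneSpectrum (𝓞 F) // v ∉ S} =>
              ((asaiLocalPolynomial c A θ (placeAbove E v.1)).eval
                ((v.1.residueCard : ℂ) ^ (-s)))⁻¹) ∧
          (∃ G : ℂ → ℂ, DifferentiableOn ℂ G {s : ℂ | 1 / 2 < s.re} ∧
            (∀ s : ℂ, σ₀ < s.re → G s = (s - 1) * partialAsaiL S c A η s) ∧ G 1 ≠ 0) ∧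
          (∃ H : ℂ → ℂ, DifferentiableOn ℂ H {s : ℂ | 1 / 2 < s.re} ∧
            (∀ s : ℂ, σ₀ < s.re → H s = partialAsaiL S c A (-η) s) ∧ H 1 ≠ 0) :=
  π.exists_sign_partialAsaiL_continuation_of_asaiEntire_of_JS hGSa
    (fun _ _ => JacquetShalika1981_partialPairL_pole_of_eq_conj_holds_of_le_two hN2) h2 hc hN hπ

end Datum

/-! ### Mok's dichotomy from `hGS` / `hGSa` and Corollaire (ii) alone -/

section Assembly

/-- **Mok's Asai-pole dichotomy (`Mok2014_partialAsaiL_continuation_pole_dichotomy`) from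
Grbac–Shahidi's Thm. 4.3 (2)(a) in `L²_cusp` and Arthur–Clozel's (2.3) — nothing else.**  Hypotheses:
`hGSa` (Grbac–Shahidi 2015, Thm. 4.3 (2)(a), holomorphy clause, partial form, `L²` currency, for every
quadratic `E/F` with `c ≠ 1`, `N ≥ 1`, automorphic measure, cuspidal `P ≤ L²_cusp`, finite `S` with
the inert condition, `L²` family `A` of `P` off `S_E`, sign `η`: `s (s - 1) L^S(s, P, As^η)` is on some
`{σ₀ < Re s}` the restriction of an entire function — the first conjunct of the named fact
`GrbacShahidi2015_partialAsaiL_holomorphy`) and `h23` (the named fact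
`JacquetShalika1981_partialPairL_pole_of_eq_conj`, Arthur–Clozel's (2.3), over every number field, in
every rank, for every automorphic measure — a theorem of the tree in ranks `≤ 2`, and a consequence of
Mœglin–Waldspurger's Corollaire (ii) in general).  Pointwise:
`CuspidalAutomorphicRepData.exists_sign_partialAsaiL_continuation_of_asaiEntire_of_JS`.
[cite: Mok2014, §2.5 (paragraph before Thm. 2.5.4) and Thm. 2.5.4 (a), p. 20]
[cite: GrbacShahidi2015, §2.A p. 190, Thm. 4.3 (2)(a) and its proof, pp. 204–206]
[cite: ArthurClozelAMS120, Ch. 3 §2 (2.1), (2.3)] [cite: JacquetShalikaAJM1981, Cor. (2.5), Thm. (5.3)] -/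
theorem Mok2014_partialAsaiL_continuation_pole_dichotomy_of_asaiEntire_of_JS
    (hGSa : ∀ (F E : Type) [Field F] [NumberField F] [Field E] [NumberField E] [Algebra F E]
      (c : E ≃ₐ[F] E), Module.finrank F E = 2 → c ≠ 1 →
      ∀ (N : ℕ) (μ : Measure (gl N E).automorphicQuotient) [(gl N E).IsAutomorphicMeasure μ]
        (P : CuspidalAutomorphicRepGL N E μ), 0 < N →
        ∀ (S : Set (HeightOneSpectrum (𝓞 F))) (A : SatakeFamily E) (η : ℤˣ), S.Finite →
          IsSatakeFamilyOf P {w : HeightOneSpectrum (𝓞 E) | w.under (𝓞 F) ∈ S} A →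
          (∀ w : HeightOneSpectrum (𝓞 E), w.under (𝓞 F) ∉ S → c • w = w →
            w.asIdeal.inertiaDeg (𝓞 F) = 2) →
          ∃ σ₀ : ℝ, 1 ≤ σ₀ ∧ ∃ G : ℂ → ℂ, Differentiable ℂ G ∧
            ∀ s : ℂ, σ₀ < s.re → G s = s * (s - 1) * partialAsaiL S c A η s)
    (h23 : ∀ (E : Type) [Field E] [NumberField E] (N : ℕ)
      (μ : Measure (gl N E).automorphicQuotient) [(gl N E).IsAutomorphicMeasure μ],
      JacquetShalika1981_partialPairL_pole_of_eq_conj (n := N) (K := E) (μ := μ)) :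
    Mok2014_partialAsaiL_continuation_pole_dichotomy := by
  intro F E _ _ _ _ _ c h2 hc N hcpt π hN hπ
  have hGSa' := fun (μ : Measure (gl N E).automorphicQuotient) (_ : (gl N E).IsAutomorphicMeasure μ)
    (P : CuspidalAutomorphicRepGL N E μ) (S : Set (HeightOneSpectrum (𝓞 F))) (A : SatakeFamily E)
    (η : ℤˣ) => hGSa F E c h2 hc N μ P hN S A η
  exact π.exists_sign_partialAsaiL_continuation_of_asaiEntire_of_JS hGSa' (h23 E N) h2 hc hN hπ

/-- **Mok's dichotomy from the two NAMED FACTS `GrbacShahidi2015_partialAsaiL_holomorphy` and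
`JacquetShalika1981_partialPairL_pole_of_eq_conj` alone**: the named fact
`Mok2014_partialAsaiL_continuation_pole_dichotomy` follows from Grbac–Shahidi 2015, Thm. 4.3 (1), (2)(a)
as vendored in `PartialAsaiLHolomorphy` (only clause (2)(a) is used) and Arthur–Clozel's (2.3) over
every number field, in every rank, for every automorphic measure
(`Mok2014_partialAsaiL_continuation_pole_dichotomy_of_asaiEntire_of_JS`).
[cite: Mok2014, §2.5 and Thm. 2.5.4 (a), p. 20] [cite: GrbacShahidi2015, Thm. 4.3 (1), (2)(a),
pp. 190–191, proof pp. 204–206] [cite: ArthurClozelAMS120, Ch. 3 §2 (2.3)] -/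
theorem Mok2014_partialAsaiL_continuation_pole_dichotomy_of_GrbacShahidi2015_of_JS
    (hGS : GrbacShahidi2015_partialAsaiL_holomorphy)
    (h23 : ∀ (E : Type) [Field E] [NumberField E] (N : ℕ)
      (μ : Measure (gl N E).automorphicQuotient) [(gl N E).IsAutomorphicMeasure μ],
      JacquetShalika1981_partialPairL_pole_of_eq_conj (n := N) (K := E) (μ := μ)) :
    Mok2014_partialAsaiL_continuation_pole_dichotomy := by
  refine Mok2014_partialAsaiL_continuation_pole_dichotomy_of_asaiEntire_of_JS ?_ h23
  intro F E _ _ _ _ _ c h2 hc N μ _ P hN S A η hS hA hinert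
  obtain ⟨σ₀, hσ₀, hG, -⟩ := hGS F E c h2 hc N μ P hN S A η hS hA hinert
  exact ⟨σ₀, hσ₀, hG⟩

/-- **Mok's Asai-pole dichotomy (`Mok2014_partialAsaiL_continuation_pole_dichotomy`) from
Grbac–Shahidi's Thm. 4.3 (2)(a) in `L²_cusp` and Mœglin–Waldspurger's Corollaire (ii) — nothing
else.**  Hypotheses:

* `hGSa` — Grbac–Shahidi 2015, Thm. 4.3 (2)(a), holomorphy clause, partial form, `L²` currency (for
  every quadratic `E/F` with `c ≠ 1`, `N ≥ 1`, automorphic measure `μ`, cuspidal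
  `P ≤ L²_cusp(GL_N(E) A_G \ GL_N(𝔸_E), μ)`, finite `S` off which the `c`-fixed places are inert,
  `L²` Satake family `A` of `P` off `S_E` and sign `η`, `s (s - 1) L^S(s, P, As^η)` is on some
  `{σ₀ < Re s}` the restriction of an entire function) — the first conjunct of the named fact
  `GrbacShahidi2015_partialAsaiL_holomorphy`;
* `hMW` — the named fact `MoeglinWaldspurger1989_partialPairL_of_eq_conj` (Corollaire (ii):
  `s (s - 1) L^S(s, π ⊗ π̄)` extends to an entire function) over every number field, in every rank,
  for every automorphic measure.

Proof: `Mok2014_partialAsaiL_continuation_pole_dichotomy_of_holomorphy_of_L2` (Mok's order count at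
`s = 1`, at a large datum, transported down to every datum) with `hHol` from
`hol_half_plane_of_asaiEntire_of_dict` over the normalised dictionary
`exists_hasSatakeParamAt_iff_L2_of_asaiEntire` (`z = 0` from (2)(a) and (2.3)), `hJS` = (2.3) from
Corollaire (ii) (`JacquetShalika1981_partialPairL_pole_of_eq_conj_of_moeglinWaldspurger`), and `hNV`
from `eval_asaiLocalPolynomial_at_one_ne_zero_of_dict_of_MW` (the strict Jacquet–Shalika bound from
Corollaire (ii)). [cite: Mok2014, §2.5 (paragraph before Thm. 2.5.4) and Thm. 2.5.4 (a), p. 20]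
[cite: GrbacShahidi2015, §2.A p. 190, Thm. 4.3 (2)(a) and its proof, pp. 204–206]
[cite: MoeglinWaldspurger1989, Appendice, Corollaire (ii), p. 667]
[cite: JacquetShalikaAJM1981, Cor. (2.5), Thm. (5.3)] -/
theorem Mok2014_partialAsaiL_continuation_pole_dichotomy_of_asaiEntire_of_MW
    (hGSa : ∀ (F E : Type) [Field F] [NumberField F] [Field E] [NumberField E] [Algebra F E]
      (c : E ≃ₐ[F] E), Module.finrank F E = 2 → c ≠ 1 →
      ∀ (N : ℕ) (μ : Measure (gl N E).automorphicQuotient) [(gl N E).IsAutomorphicMeasure μ]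
        (P : CuspidalAutomorphicRepGL N E μ), 0 < N →
        ∀ (S : Set (HeightOneSpectrum (𝓞 F))) (A : SatakeFamily E) (η : ℤˣ), S.Finite →
          IsSatakeFamilyOf P {w : HeightOneSpectrum (𝓞 E) | w.under (𝓞 F) ∈ S} A →
          (∀ w : HeightOneSpectrum (𝓞 E), w.under (𝓞 F) ∉ S → c • w = w →
            w.asIdeal.inertiaDeg (𝓞 F) = 2) →
          ∃ σ₀ : ℝ, 1 ≤ σ₀ ∧ ∃ G : ℂ → ℂ, Differentiable ℂ G ∧
            ∀ s : ℂ, σ₀ < s.re → G s = s * (s - 1) * partialAsaiL S c A η s)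
    (hMW : ∀ (E : Type) [Field E] [NumberField E] (N : ℕ)
      (μ : Measure (gl N E).automorphicQuotient) [(gl N E).IsAutomorphicMeasure μ],
      MoeglinWaldspurger1989_partialPairL_of_eq_conj (n := N) (K := E) (μ := μ)) :
    Mok2014_partialAsaiL_continuation_pole_dichotomy :=
  -- (2.3) is a theorem under Corollaire (ii)
  Mok2014_partialAsaiL_continuation_pole_dichotomy_of_asaiEntire_of_JS hGSa fun E _ _ N μ _ =>
    JacquetShalika1981_partialPairL_pole_of_eq_conj_of_moeglinWaldspurger (hMW E N μ)

/-- **Mok's dichotomy from the two NAMED FACTS `GrbacShahidi2015_partialAsaiL_holomorphy` and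
`MoeglinWaldspurger1989_partialPairL_of_eq_conj` alone** (main theorem of this file): the named fact
`Mok2014_partialAsaiL_continuation_pole_dichotomy` follows from Grbac–Shahidi 2015, Thm. 4.3 (1),
(2)(a) as vendored in `PartialAsaiLHolomorphy` (only clause (2)(a) is used) and Mœglin–Waldspurger's
Corollaire (ii) over every number field, in every rank, for every automorphic measure
(`Mok2014_partialAsaiL_continuation_pole_dichotomy_of_asaiEntire_of_MW`).  These are exactly the two
inputs modulo which `GrbacShahidi2015_partialAsaiL_at_one` is closed by
`GrbacShahidi2015_partialAsaiL_at_one_of_asaiHolomorphy_of_moeglinWaldspurger`.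
[cite: Mok2014, §2.5 and Thm. 2.5.4 (a), p. 20] [cite: GrbacShahidi2015, Thm. 4.3 (1), (2)(a),
pp. 190–191, proof pp. 204–206] [cite: MoeglinWaldspurger1989, Appendice, Corollaire (ii), p. 667] -/
theorem Mok2014_partialAsaiL_continuation_pole_dichotomy_of_GrbacShahidi2015_of_MW
    (hGS : GrbacShahidi2015_partialAsaiL_holomorphy)
    (hMW : ∀ (E : Type) [Field E] [NumberField E] (N : ℕ)
      (μ : Measure (gl N E).automorphicQuotient) [(gl N E).IsAutomorphicMeasure μ],
      MoeglinWaldspurger1989_partialPairL_of_eq_conj (n := N) (K := E) (μ := μ)) :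
    Mok2014_partialAsaiL_continuation_pole_dichotomy := by
  refine Mok2014_partialAsaiL_continuation_pole_dichotomy_of_asaiEntire_of_MW ?_ hMW
  intro F E _ _ _ _ _ c h2 hc N μ _ P hN S A η hS hA hinert
  obtain ⟨σ₀, hσ₀, hG, -⟩ := hGS F E c h2 hc N μ P hN S A η hS hA hinert
  exact ⟨σ₀, hσ₀, hG⟩

/-- **Mok's dichotomy from the named fact `GrbacShahidi2015_partialAsaiL_holomorphy` and the
Jacquet–Shalika / multiplicity-one facts at `s = 1`** — the accepted
`Mok2014_partialAsaiL_continuation_pole_dichotomy_of_asaiHolomorphy_of_L2'` fed with the vendored fact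
(its hypothesis `hGS` verbatim), recorded for comparison with
`Mok2014_partialAsaiL_continuation_pole_dichotomy_of_GrbacShahidi2015_of_MW`: here the `L²` inputs are
`JacquetShalika1981_partialPairL_at_one_of_ne_conj` ((2.2) at `s = 1`),
`JacquetShalika1981_partialPairL_pole_of_eq_conj` ((2.3)) and `multiplicity_one_gl`.
[cite: Mok2014, §2.5 and Thm. 2.5.4 (a), p. 20] [cite: GrbacShahidi2015, Thm. 4.3 (1), (2)(a)]
[cite: ArthurClozelAMS120, Ch. 3 §2 (2.2)–(2.3)] -/
theorem Mok2014_partialAsaiL_continuation_pole_dichotomy_of_GrbacShahidi2015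
    (hGS : GrbacShahidi2015_partialAsaiL_holomorphy)
    (h22 : ∀ (E : Type) [Field E] [NumberField E] (N : ℕ)
      (μ : Measure (gl N E).automorphicQuotient) [(gl N E).IsAutomorphicMeasure μ],
      JacquetShalika1981_partialPairL_at_one_of_ne_conj (n := N) (K := E) (μ := μ))
    (h23 : ∀ (E : Type) [Field E] [NumberField E] (N : ℕ)
      (μ : Measure (gl N E).automorphicQuotient) [(gl N E).IsAutomorphicMeasure μ],
      JacquetShalika1981_partialPairL_pole_of_eq_conj (n := N) (K := E) (μ := μ))
    (hm1 : ∀ (E : Type) [Field E] [NumberField E] (N : ℕ)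
      (μ : Measure (gl N E).automorphicQuotient) [(gl N E).IsAutomorphicMeasure μ],
      multiplicity_one_gl N E μ) :
    Mok2014_partialAsaiL_continuation_pole_dichotomy :=
  Mok2014_partialAsaiL_continuation_pole_dichotomy_of_asaiHolomorphy_of_L2'
    (fun F E _ _ _ _ _ c h2 hc N μ _ P hN S A η hS hA hinert =>
      hGS F E c h2 hc N μ P hN S A η hS hA hinert) h22 h23 hm1

end Assembly

end Literature.NumberTheory.Automorphic
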